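import Summits.HodgeConjecture.HodgeConjecture.Theorems.CyclicUnitaryPowersUninodalTernaryForm
import Literature.AlgebraicGeometry.HodgeTheory.UniversalHypersurfaceDiscriminantBranches
import Literature.AlgebraicGeometry.HodgeTheory.CyclicCoverMeridianMonodromy
import Literature.AlgebraicGeometry.HodgeTheory.CyclicCoverBaseChart
import Literature.AlgebraicGeometry.FundamentalGroup.HypersurfaceComplementMeridiansConj
import Literature.AlgebraicGeometry.FundamentalGroup.HypersurfaceComplementMeridiansGenerate
import HarnessLib

/-!
# K1-A input: a meridian of the discriminant of the cyclic family CENTRED AT A ONE-NODAL CURVE exists at every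
# base point, and the meridians with that centre generate `π₁` (route `CyclicUnitaryPowers`, item stmt-HodgeConjecture-19544)

Helper file (`--supports stmt-HodgeConjecture-19544`) of the prover seat `hodge-nonav-prover-Ax` (g8), cell `hodge-nonav`.
Sorry-free; axioms standard; no definition, no named fact.

The registered binder `stub_ct99MeridianReflection` of crux K1 is the cited LOCAL fact
`carlsonToledo1999_meridianMonodromy_isCyclicReflection` (CT99 §6 Proposition), typed for EVERY meridian of the
discriminant `V(D)` of the universal family of `p`-cyclic covers of the plane — i.e. for every transversal disc at
every point `y ∈ V(D)` with `∇D(y) ≠ 0`. Read this way it silently contains the classical theorem "a smooth point of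
the discriminant of plane curves of degree `p` is a curve with exactly one node" (CT99 §1 asserts it: "Consider a
smooth point `c` of the discriminant locus. For these `X_c` has exactly one node"), whose proof (multiplicity of the
discriminant `=` total Milnor number) is a theorem of its own. The derivation of the Picard–Lefschetz package
(`CyclicUnitaryPowersPLPackageOfMeridians`) needs much less: ONE meridian whose centre is a one-nodal curve, because
Zariski–van Kampen gives `π₁` as the normal closure of one meridian and the conjugates of a meridian class are classes
of meridians WITH THE SAME CENTRE (change of leash, `Meridian.precomp`). This file supplies that input as THEOREMS:

* §1 `mem_singularCoeffs_iff_of_isDiscriminantEquation` — an equation `D` of the discriminant of the cyclic family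
  (`IsDiscriminantEquation`: `x₃^p − f_b` singular) is an equation of the discriminant of ternary `p`-forms
  (`singularCoeffs 1 p`: `V(f_b)` singular), `p ≥ 2`.
* §2 `exists_eval_pderiv_ne_zero_of_uninodal` — **at a ONE-NODAL form the discriminant equation has a non-zero
  gradient** (any `n, d`): from the tree's PROVED local structure theorem
  `discriminant_localBranches_nodal_holds` (Voisin II §2.1.1 Lemma 2.7 / Cor. 2.8; littype-FH1-2 g16:
  `Disc = u · φ` near `a₁ = coeff f₁`, `u(a₁) ≠ 0`, `φ(a₁) = 0`, `dφ(a₁) = c · ev_x`, `c ≠ 0`) by the product rule and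
  `ev_x ≠ 0`.
* §3 `exists_meridian_center_uninodal` — **for `p ≥ 3` and every base point `s` of `{D ≠ 0}` there is a meridian of
  `V(D)` based at `s` whose centre is (the coefficient vector of) a ONE-NODAL ternary `p`-form**: the explicit form
  `x₂^{p−2} x₀ x₁ + x₀^p + x₁^p` (`CyclicUnitaryPowersUninodalTernaryForm`) is a smooth point of `V(D)` by §2, and the
  tree's `MeridianConj.exists_meridian_of_mem_goodLocus` draws a leashed transversal disc there.
* §4 `closure_meridian_loopClasses_center_eq_top` — **the classes of the meridians with one prescribed centre
  generate `π₁(ℂ^N ∖ V(D))`** (Zariski–van Kampen `affineHypersurfaceComplement_meridians_normalClosure_eq_top_holds`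
  for one of them; conjugation only changes the leash, `exists_meridian_loopClass_eq_conj_center`).

Consumer: `CyclicUnitaryPowersPLPackageOfNodalMeridian` (the Picard–Lefschetz package, K1 and the rung leaf from the
meridian fact RE-CUT to one-nodal centres). Nothing here says HC ∕ HC_AV is proved; rung F-H1 is not moved.

## References

* [CarlsonToledo1999] J. A. Carlson, D. Toledo, Discriminant complements and kernels of monodromy representations,
  Duke Math. J. 97 (1999), §1 (meridians; "`X_c` has exactly one node"), §3, §6 Proposition.
* [VoisinHodgeII2003] C. Voisin, Hodge Theory and Complex Algebraic Geometry II, CUP 2003, §2.1.1 Lemma 2.7, Cor. 2.8.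
* [Shimada2010ZvK] I. Shimada, Lectures on Zariski–van Kampen theorem, arXiv:0906.1074, §3 Prop. 3.4.
-/

-- `Summit.HodgeConjecture.HodgeConjecture.Theorems` is the mandated namespace (single-problem summit), which
-- `linter.dupNamespace` flags; the lakefile turns the linter off tree-wide, restated here for stand-alone checks.
set_option linter.dupNamespace false

noncomputable section

open MvPolynomial _root_.Topology _root_.Filter
open Literature.AlgebraicGeometry.Motives Literature.AlgebraicGeometry.Motives.UniversalHypersurface
open Literature.AlgebraicGeometry.HodgeTheory Literature.AlgebraicGeometry.HodgeTheory.DiscriminantBranches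
open Literature.AlgebraicGeometry.FundamentalGroup
open Literature.NumberTheory.Transcendental (hasFDerivAt_eval)
open Summit.HodgeConjecture.HodgeConjecture.Theorems.CyclicUnitaryPowersUninodalTernaryForm

namespace Summit.HodgeConjecture.HodgeConjecture.Theorems.CyclicUnitaryPowersNodalMeridianExists

/-! ### §1 The discriminant of the cyclic family is the discriminant of ternary forms -/

/-- The tree's `formOfCoeffs` for plane curves of degree `p` (`n = 1`) is the ternary form `Σ_e b_e x^e`
(same index type `{e : Fin 3 →₀ ℕ // |e| = p}`). [folklore] -/
theorem formOfCoeffs_eq_sum {p : ℕ} (b : TernaryIndex p → ℂ) :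
    formOfCoeffs (n := 1) (d := p) b = ∑ e : TernaryIndex p, monomial e.1 (b e) := rfl

/-- An equation of the discriminant of the cyclic family (`x₃^p − f_b` singular) is an equation of the discriminant
of ternary `p`-forms (`V(f_b)` singular, `singularCoeffs 1 p`), `p ≥ 2`. [cite: CarlsonToledo1999, §2 (held text p0004)] -/
theorem mem_singularCoeffs_iff_of_isDiscriminantEquation {p : ℕ} (hp : 2 ≤ p) {D : MvPolynomial (TernaryIndex p) ℂ}
    (hDeq : IsDiscriminantEquation p D) (a : DegIndex 1 p → ℂ) : a ∈ singularCoeffs 1 p ↔ eval a D = 0 := by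
  rw [hDeq a, mem_singularCoeffs_iff, formOfCoeffs_eq_sum, isNonsingularForm_cyclicCoverForm_iff hp]

/-! ### §2 The gradient of the discriminant at a one-nodal form -/

/-- **At a ONE-NODAL form the (irreducible) equation of the discriminant has a non-zero partial derivative**:
`Disc = u · φ` near `a₁ = coeff f₁` with `u(a₁) ≠ 0`, `φ(a₁) = 0`, `dφ(a₁) = c · ev_x`, `c ≠ 0`
(`discriminant_localBranches_nodal_holds`), so `dDisc(a₁) = u(a₁) c · ev_x ≠ 0`, and the partials are the coordinates
of `dDisc(a₁)`. [cite: VoisinHodgeII2003, §2.1.1 Lemma 2.7 and Cor. 2.8] -/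
theorem exists_eval_pderiv_ne_zero_of_uninodal {n d : ℕ} {Disc : MvPolynomial (DegIndex n d) ℂ}
    (hirr : Irreducible Disc) (hV : ∀ a : DegIndex n d → ℂ, a ∈ singularCoeffs n d ↔ eval a Disc = 0)
    {f₁ : MvPolynomial (Fin (n + 2)) ℂ} (hf₁ : f₁.IsHomogeneous d) {x : Fin (n + 2) → ℂ}
    (hnod : IsNodalFormWithNodes f₁ ![x]) :
    ∃ m : DegIndex n d, eval (coeffsOf n d f₁) (pderiv m Disc) ≠ 0 := by
  classical
  obtain ⟨W, hWo, haW, φ, u, c, hφ, hu, hu0, hDW⟩ :=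
    discriminant_localBranches_nodal_holds n d 1 Disc hirr hV f₁ hf₁ ![x] hnod
  obtain ⟨-, hφ0, hc0, hdφ⟩ := hφ 0
  set a₁ := coeffsOf n d f₁ with ha₁
  -- the derivative of `u · φ₀` at `a₁`
  have hdu : HasFDerivAt u (fderiv ℂ u a₁) a₁ :=
    ((hu a₁ haW).differentiableAt (hWo.mem_nhds haW)).hasFDerivAt
  have hprod : HasFDerivAt (fun a => u a * φ 0 a)
      (u a₁ • (c 0 • evalCoeffCLM n d (![x] 0)) + φ 0 a₁ • fderiv ℂ u a₁) a₁ := hdu.mul hdφ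
  -- `Disc = u · φ₀` near `a₁`
  have hEq : (fun a => eval a Disc) =ᶠ[𝓝 a₁] fun a => u a * φ 0 a := by
    filter_upwards [hWo.mem_nhds haW] with a ha
    rw [hDW a ha, Fin.prod_univ_one]
  have hD : HasFDerivAt (fun a => eval a Disc)
      (u a₁ • (c 0 • evalCoeffCLM n d (![x] 0)) + φ 0 a₁ • fderiv ℂ u a₁) a₁ :=
    hprod.congr_of_eventuallyEq hEq
  have hL := (hasFDerivAt_eval Disc a₁).unique hD
  -- a coefficient vector at which `ev_x` does not vanish
  have hx0 : x ≠ 0 := (hnod.1 0).ne_zero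
  obtain ⟨w, hw⟩ := exists_evalCoeffCLM_ne_zero (n := n) (d := d) hx0
  have hLw := congrArg (fun L : (DegIndex n d → ℂ) →L[ℂ] ℂ => L w) hL
  simp only [_root_.sum_apply, _root_.smul_apply, ContinuousLinearMap.proj_apply, smul_eq_mul,
    _root_.add_apply, hφ0, zero_mul, add_zero, Matrix.cons_val_fin_one] at hLw
  by_contra hall
  push Not at hall
  have hzero : ∑ m, eval a₁ (pderiv m Disc) * w m = 0 :=
    Finset.sum_eq_zero fun m _ => by rw [hall m, zero_mul]
  rw [hzero] at hLw
  exact mul_ne_zero (hu0 a₁ haW) (mul_ne_zero hc0 hw) hLw.symm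

/-- A one-nodal form is singular: its coefficient vector lies on the discriminant. [cite: VoisinHodgeII2003, §2.3.1] -/
theorem coeffsOf_mem_singularCoeffs_of_uninodal {n d : ℕ} (hd : 1 ≤ d) {f₁ : MvPolynomial (Fin (n + 2)) ℂ}
    (hf₁ : f₁.IsHomogeneous d) {x : Fin (n + 2) → ℂ} (hnod : IsNodalFormWithNodes f₁ ![x]) :
    coeffsOf n d f₁ ∈ singularCoeffs n d := by
  rw [mem_singularCoeffs_iff_exists]
  refine ⟨x, (hnod.1 0).ne_zero, ?_, fun j => ?_⟩
  · rw [formOfCoeffs_coeffsOf _ _ hf₁]; exact (hnod.1 0).eval_eq_zero hf₁ hd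
  · rw [formOfCoeffs_coeffsOf _ _ hf₁]; exact (hnod.1 0).eval_pderiv j

/-! ### §3 A meridian centred at a one-nodal curve -/

/-- **For `p ≥ 3` there is, at every base point of `{D ≠ 0}`, a meridian of the discriminant `V(D)` of the cyclic family
whose centre is a ONE-NODAL ternary `p`-form** (the degeneration "`X_c` has exactly one node" of CT99 §1, here CHOSEN, not
deduced from smoothness of the discriminant): centre the explicit one-nodal form `x₂^{p−2} x₀ x₁ + x₀^p + x₁^p`, a smooth
point of `V(D)` by `exists_eval_pderiv_ne_zero_of_uninodal`. [cite: CarlsonToledo1999, §1 (held text p0003)]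
[cite: Shimada2010ZvK, §3 (leashed discs)] -/
theorem exists_meridian_center_uninodal {p : ℕ} (hp : 3 ≤ p) {D : MvPolynomial (TernaryIndex p) ℂ}
    (hirr : Irreducible D) (hDeq : IsDiscriminantEquation p D) (s : affineHypersurfaceComplement ![D]) :
    ∃ (μ : Meridian ![D] s 0) (x : Fin 3 → ℂ),
      IsNodalFormWithNodes (n := 1) (∑ e : TernaryIndex p, monomial e.1 (μ.y e)) ![x] := by
  obtain ⟨f₁, x, hf₁, -, hnod⟩ := exists_uninodal_ternaryForm hp
  have hV : ∀ a : DegIndex 1 p → ℂ, a ∈ singularCoeffs 1 p ↔ eval a D = 0 :=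
    mem_singularCoeffs_iff_of_isDiscriminantEquation (by omega) hDeq
  obtain ⟨k, hk⟩ := exists_eval_pderiv_ne_zero_of_uninodal hirr hV hf₁ hnod
  have hmem : coeffsOf 1 p f₁ ∈ MeridianConj.goodLocus ![D] 0 := by
    refine ⟨(hV _).1 (coeffsOf_mem_singularCoeffs_of_uninodal (by omega) hf₁ hnod),
      fun i hi => absurd (Subsingleton.elim i 0) hi, k, ?_⟩
    simpa using hk
  have hU : IsPathConnected (affineHypersurfaceComplement ![D]) :=
    MeridianConj.isPathConnected_affineHypersurfaceComplement fun j => by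
      fin_cases j
      exact hirr.ne_zero
  obtain ⟨μ, hμ⟩ := MeridianConj.exists_meridian_of_mem_goodLocus hU s hmem
  refine ⟨μ, x, ?_⟩
  rw [hμ, ← formOfCoeffs_eq_sum, formOfCoeffs_coeffsOf _ _ hf₁]
  exact hnod

/-! ### §4 The meridians with one prescribed centre generate `π₁` -/

section Meridians

variable {ι : Type} [Fintype ι] {m : ℕ} {h : Fin m → MvPolynomial ι ℂ}
  {s : affineHypersurfaceComplement h} {j : Fin m}

/-- **Conjugates of meridian classes are classes of meridians WITH THE SAME CENTRE**: for `κ ∈ π₁(U, s)` represented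
by a loop `q` and a meridian `μ`, the meridian `μ.precomp q⁻¹` (same disc, leash `q⁻¹ · leash`) has class `κ [μ] κ⁻¹`.
[cite: Shimada2010ZvK, §3 (leashed discs)] -/
theorem exists_meridian_loopClass_eq_conj_center (κ : FundamentalGroup (affineHypersurfaceComplement h) s)
    (μ : Meridian h s j) : ∃ μ' : Meridian h s j, μ'.y = μ.y ∧ μ'.loopClass = κ * μ.loopClass * κ⁻¹ := by
  induction κ using Path.Homotopic.Quotient.ind with | mk q => ?_
  refine ⟨μ.precomp q.symm, rfl, ?_⟩
  rw [← Meridian.pathConj_loopClass]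
  change FundamentalGroup.fromPath (Path.Homotopic.Quotient.mk (q.symm.trans (μ.loop.trans q.symm.symm))) =
    FundamentalGroup.fromPath (Path.Homotopic.Quotient.mk (q.symm.trans (μ.loop.trans q)))
  rw [Path.symm_symm]

/-- **The classes of the meridians of an irreducible hypersurface with ONE PRESCRIBED CENTRE generate `π₁` of the
complement** (as a plain subgroup): Zariski–van Kampen gives the normal closure of the class of one meridian `μ₀`
(`affineHypersurfaceComplement_meridians_normalClosure_eq_top_holds`), and every conjugate of it is the class of a
meridian with the centre of `μ₀`. [cite: Shimada2010ZvK, §3 Prop. 3.4] -/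
theorem closure_meridian_loopClasses_center_eq_top {g : MvPolynomial ι ℂ} (hg : Irreducible g)
    {s : affineHypersurfaceComplement ![g]} (μ₀ : Meridian ![g] s 0) :
    Subgroup.closure {c | ∃ μ : Meridian ![g] s 0, μ.y = μ₀.y ∧ c = μ.loopClass} = ⊤ := by
  have hirr : ∀ j : Fin 1, Irreducible ((![g] : Fin 1 → MvPolynomial ι ℂ) j) := fun j => by
    fin_cases j; exact hg
  have hZ := affineHypersurfaceComplement_meridians_normalClosure_eq_top_holds ι 1 ![g] hirr s
    (Fin.cases μ₀ fun i => i.elim0)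
  rw [eq_top_iff, ← hZ, Subgroup.normalClosure]
  refine Subgroup.closure_mono fun x hx => ?_
  obtain ⟨a, ⟨j, rfl⟩, hconj⟩ := Group.mem_conjugatesOfSet_iff.mp hx
  obtain ⟨c, rfl⟩ := isConj_iff.mp hconj
  fin_cases j
  obtain ⟨μ', hy, hμ'⟩ := exists_meridian_loopClass_eq_conj_center c μ₀
  exact ⟨μ', hy, by rw [hμ']; rfl⟩

end Meridians

end Summit.HodgeConjecture.HodgeConjecture.Theorems.CyclicUnitaryPowersNodalMeridianExists

end
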